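import Literature.NumberTheory.IwasawaTheory.NarrowDefectBoundedOfClassicalMuAdjoinI
import Literature.NumberTheory.IwasawaTheory.ClassicalMuVanishesTwoPowerGaloisRatFull
import Literature.NumberTheory.IwasawaTheory.NarrowClassNumberLayerTransportAlgEquivTwo
import Literature.NumberTheory.IwasawaTheory.ClassicalMuVanishesTransportAlgEquivTwo
import Literature.NumberTheory.IwasawaTheory.NarrowFukudaCertificateLayerModels
import Mathlib.NumberTheory.NumberField.InfinitePlace.TotallyRealComplex
import HarnessLib

set_option autoImplicit false

/-!
# `μ₂ = 0` ⟹ BOUNDED NARROW `2`-DEFECT along the cyclotomic `ℤ₂`-tower of a number field with EXACTLY ONE real place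
# (odd degree, at most one real embedding — e.g. every complex cubic field): Kida's narrow `μ₂* = 0` costs nothing extra there

Topic `NumberTheory/IwasawaTheory` (namespace = path).  THEOREM-ONLY file (no definition, no named fact, no `sorry`), written by the prover seat
`bsd-line-att-p4` g33 (cell `bsd-f1-sign2`, `--supports` stmt-BirchSwinnertonDyer-22298; closes nothing; BSD is proved for no curve here).

WHAT.  For a number field `F` of ODD degree with AT MOST ONE real embedding (hence exactly one real place: signature `(1, ([F:ℚ]−1)/2)`), the two tree
theorems
* att-p3 g36 `classicalMu_of_finrank_eq_two_of_subsingleton_realEmbedding` (Iwasawa 1973 Thm. 3 at `ℓ = 2`, intrinsic, proviso-free): `μ₂ = 0` for `F` ⟹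
  `μ₂ = 0` for every totally complex quadratic `F'/F`, in particular `F(√−1)`;
* att-p4 g26 `classicalMu_and_narrowDefect_le_of_classicalMu_sup_adjoin_of_sq_eq_neg_one` (genus theory for `K(√−1)/K` run backwards, `K ⊆ ℚ̄` of odd
  degree): `μ₂ = 0` for `K(√−1)` ⟹ the narrow `2`-defect `ord₂ h⁺(K_n) − ord₂ h(K_n)` is BOUNDED along the cyclotomic `ℤ₂`-tower of `K`
combine, after modelling `F` inside `ℚ̄` and transporting along `F ≃ₐ[ℚ] K` (`√2 ∉ F`, odd degree), to

* ★★ `exists_narrowDefect_le_of_classicalMu_of_subsingleton_realEmbedding` — **`μ₂(F^cyc) = 0` ⟹ `∃ D, ∀ n, ord₂ h⁺(F_n) ≤ ord₂ h(F_n) + D`**: the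
  `r₁(F_n) = 2ⁿ` real places of the layers `F_n = F·ℚ_n` are realised by unit signs up to a bounded index — Kida's narrow hypothesis `μ₂*(F) = 0`
  is AUTOMATIC from `μ₂(F) = 0` for such `F`;
* `exists_narrowDefect_le_of_classicalMu_of_not_isTotallyReal_cubic` — the cubic case keyed on `¬ IsTotallyReal F` (a cubic field which is not totally
  real has exactly one real place);
* `subsingleton_ringHom_real_of_nrRealPlaces_le_one` (glue).
WHY (cell `bsd-f1-sign2`, crux C2): this is the W-FREE reason why the named input «narrow `μ₂⁺ = 0` for every non-cyclic cubic field» of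
`Summits/…/AlignedTransportAtTwoMainConjectureOfRankZeroBSDAtTwoNarrowCubicNamedInput` carries NO narrow clause on complex cubics (the sign-split form of
`…NarrowCubicNamedInputSignSplit`): there the clause is a theorem.  For TOTALLY REAL fields nothing of the kind is claimed (Greenberg–Kida, open).

References: [Iwasawa1973MuInvariants] Thm. 2/3, §3–§4; [Kida1982JFields] Thm. 1 and its proof (p. 343), Remark (ii); [Washington1997] §13.3 Prop. 13.22–13.23;
[Gras2003] IV.4 (genus theory); tree: `NarrowDefectBoundedOfClassicalMuAdjoinI`, `ClassicalMuVanishesTwoPowerGaloisRatFull`, `NarrowClassNumberLayerTransportAlgEquivTwo`.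
-/

noncomputable section

open scoped NumberField IntermediateField
open NumberField Field IntermediateField Polynomial Module

namespace Literature.NumberTheory.IwasawaTheory

open Literature.NumberTheory.EllipticCurves Literature.NumberTheory.EllipticCurves.ZpExtension
  Literature.NumberTheory.GaloisRepresentations Literature.NumberTheory.NumberFields

/-! ### §1 Glue: one real place -/

/-- A number field with at most one real PLACE has at most one real EMBEDDING `F →+* ℝ` (a real embedding is recovered from its place).
[cite: Washington1997, §13.3 (signatures)] -/
theorem subsingleton_ringHom_real_of_nrRealPlaces_le_one (F : Type) [Field F] [NumberField F] (h1 : InfinitePlace.nrRealPlaces F ≤ 1) :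
    Subsingleton (F →+* ℝ) := by
  classical
  have hsub : Subsingleton {φ : F →+* ℂ // ComplexEmbedding.IsReal φ} := by
    rw [← Fintype.card_le_one_iff_subsingleton, InfinitePlace.card_real_embeddings]
    exact h1
  refine ⟨fun ρ₁ ρ₂ ↦ ?_⟩
  have hreal : ∀ ρ : F →+* ℝ, ComplexEmbedding.IsReal (Complex.ofRealHom.comp ρ) := fun ρ ↦ by
    rw [ComplexEmbedding.isReal_iff]
    ext x
    simp [ComplexEmbedding.conjugate_coe_eq]
  have h := congrArg Subtype.val (Subsingleton.elim (α := {φ : F →+* ℂ // ComplexEmbedding.IsReal φ})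
    ⟨_, hreal ρ₁⟩ ⟨_, hreal ρ₂⟩)
  ext x
  have hx := DFunLike.congr_fun h x
  simpa using hx

/-- A cubic field which is NOT totally real has exactly one real place. [cite: Washington1997, §13.3 (signatures)] -/
theorem nrRealPlaces_eq_one_of_not_isTotallyReal_cubic (F : Type) [Field F] [NumberField F] (hF : finrank ℚ F = 3)
    (hR : ¬ IsTotallyReal F) : InfinitePlace.nrRealPlaces F = 1 := by
  have h := InfinitePlace.card_add_two_mul_card_eq_rank F
  rw [hF] at h
  have hc : InfinitePlace.nrComplexPlaces F ≠ 0 := fun h0 ↦ hR (NumberField.nrComplexPlaces_eq_zero_iff.mp h0)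
  omega

/-! ### §2 The model in `ℚ̄` and the theorem -/

/-- `[K ⊔ ℚ⟮i⟯ : ℚ] = 2·[K : ℚ]` for `K ⊆ ℚ̄` of ODD degree and `i² = −1` (degrees `[K:ℚ]` and `2` are coprime and both divide the compositum's).
[cite: Washington1997, §13.3] -/
theorem finrank_sup_adjoin_eq_two_mul_of_odd (K : IntermediateField ℚ (AlgebraicClosure ℚ)) [FiniteDimensional ℚ ↥K]
    (hodd : Odd (finrank ℚ ↥K)) {i : AlgebraicClosure ℚ} (hi : i ^ 2 = -1) :
    finrank ℚ ↥(K ⊔ IntermediateField.adjoin ℚ ({i} : Set (AlgebraicClosure ℚ))) = 2 * finrank ℚ ↥K := by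
  set Qi : IntermediateField ℚ (AlgebraicClosure ℚ) := IntermediateField.adjoin ℚ ({i} : Set (AlgebraicClosure ℚ)) with hQi
  have hint : IsIntegral ℚ i := ⟨X ^ 2 + 1, monic_X_pow_add_C _ two_ne_zero, by simp [hi]⟩
  haveI : FiniteDimensional ℚ ↥Qi := IntermediateField.adjoin.finiteDimensional hint
  haveI : FiniteDimensional ℚ ↥(K ⊔ Qi) := IntermediateField.finiteDimensional_sup K Qi
  -- `[ℚ(i) : ℚ] = 2`
  have hQi2 : finrank ℚ ↥Qi = 2 := by
    rw [hQi, IntermediateField.adjoin.finrank hint]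
    have hirr : Irreducible (X ^ 2 + 1 : ℚ[X]) := by
      refine irreducible_of_degree_le_three_of_not_isRoot (by rw [show (X ^ 2 + 1 : ℚ[X]) = X ^ 2 - C (-1) by simp, natDegree_X_pow_sub_C]; decide)
        fun q hq ↦ ?_
      have : q ^ 2 + 1 = 0 := by simpa using hq
      nlinarith [sq_nonneg q]
    have hmon : (X ^ 2 + 1 : ℚ[X]).Monic := by
      rw [show (X ^ 2 + 1 : ℚ[X]) = X ^ 2 - C (-1) by simp]; exact monic_X_pow_sub_C _ two_ne_zero
    rw [← minpoly.eq_of_irreducible_of_monic hirr (by simp [hi]) hmon,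
      show (X ^ 2 + 1 : ℚ[X]) = X ^ 2 - C (-1) by simp, natDegree_X_pow_sub_C]
  have hle : finrank ℚ ↥(K ⊔ Qi) ≤ finrank ℚ ↥K * finrank ℚ ↥Qi := IntermediateField.finrank_sup_le K Qi
  have hdK : finrank ℚ ↥K ∣ finrank ℚ ↥(K ⊔ Qi) := IntermediateField.finrank_dvd_of_le_right (le_sup_left : K ≤ K ⊔ Qi)
  have hd2 : 2 ∣ finrank ℚ ↥(K ⊔ Qi) := hQi2 ▸ IntermediateField.finrank_dvd_of_le_right (le_sup_right : Qi ≤ K ⊔ Qi)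
  have hcop : Nat.Coprime 2 (finrank ℚ ↥K) := (Nat.coprime_two_left).mpr hodd
  have hd : 2 * finrank ℚ ↥K ∣ finrank ℚ ↥(K ⊔ Qi) := Nat.Coprime.mul_dvd_of_dvd_of_dvd hcop hd2 hdK
  have hpos : 0 < finrank ℚ ↥(K ⊔ Qi) := finrank_pos
  rw [hQi2] at hle
  obtain ⟨c, hc⟩ := hd
  rcases Nat.eq_zero_or_pos c with rfl | hc1
  · omega
  · have : c = 1 := by nlinarith [finrank_pos (R := ℚ) (M := ↥K)]
    rw [hc, this, mul_one]

/-- ★★ **`μ₂ = 0` ⟹ BOUNDED NARROW `2`-DEFECT, for a number field with exactly one real place.**  `F` of ODD degree with at most one real embedding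
(e.g. every complex cubic field); if every cyclotomic `ℤ₂`-extension of `F` has `μ = 0` (growth form), then for some `D` and every cyclotomic
`ℤ₂`-extension `κ` of `F`: `ord₂ h⁺(F_n) ≤ ord₂ h(F_n) + D` for all `n` — the narrow and the wide `2`-class numbers of the layers differ by a BOUNDED power of
`2`, i.e. the units of `F_n` take all but boundedly many of the `2ⁿ` sign patterns at the real places.  (Iwasawa's quadratic ascent `F ⊂ F(√−1)` — `F(√−1)`
totally complex, `F` with one real place — followed by genus theory for `F_n(√−1)/F_n` read backwards; both tree theorems, here assembled W-free.)  Kida's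
narrow hypothesis `μ₂*(F) = 0` is thus EQUIVALENT to `μ₂(F) = 0` for such `F`. [cite: Iwasawa1973MuInvariants, Thm. 2 and Thm. 3, §3–§4]
[cite: Kida1982JFields, Thm. 1 (p. 340) and its proof (p. 343)] [cite: Washington1997, §13.3 Prop. 13.22–13.23] [cite: Gras2003, IV.4] -/
theorem exists_narrowDefect_le_of_classicalMu_of_subsingleton_realEmbedding (F : Type) [Field F] [NumberField F]
    (hodd : Odd (finrank ℚ F)) [Subsingleton (F →+* ℝ)]
    (hμ : ∀ κ : ZpExtension F 2, κ.IsCyclotomic → ClassicalMuVanishes κ) :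
    ∃ D : ℕ, ∀ κ : ZpExtension F 2, κ.IsCyclotomic → ∀ n : ℕ, ∀ [NumberField ↥(κ.layer n)],
      padicValNat 2 (narrowClassNumber ↥(κ.layer n)) ≤ padicValNat 2 (NumberField.classNumber ↥(κ.layer n)) + D := by
  haveI : Fact (Nat.Prime 2) := ⟨Nat.prime_two⟩
  -- the model `K ≅ F` inside `ℚ̄` and `K' = K ⊔ ℚ⟮i₀⟯`
  obtain ⟨i₀, hi₀⟩ : ∃ i₀ : AlgebraicClosure ℚ, i₀ ^ 2 = -1 := IsAlgClosed.exists_pow_nat_eq (-1) two_pos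
  obtain ⟨K, ⟨φ⟩⟩ : ∃ K : IntermediateField ℚ (AlgebraicClosure ℚ), Nonempty (F ≃ₐ[ℚ] ↥K) :=
    ⟨(IsAlgClosed.lift : F →ₐ[ℚ] AlgebraicClosure ℚ).fieldRange, ⟨AlgEquiv.ofInjectiveField _⟩⟩
  haveI : FiniteDimensional ℚ ↥K := LinearEquiv.finiteDimensional φ.toLinearEquiv
  haveI : NumberField ↥K := NumberField.mk
  have hint : IsIntegral ℚ i₀ := ⟨X ^ 2 + 1, monic_X_pow_add_C _ two_ne_zero, by simp [hi₀]⟩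
  haveI : FiniteDimensional ℚ ↥(IntermediateField.adjoin ℚ ({i₀} : Set (AlgebraicClosure ℚ))) :=
    IntermediateField.adjoin.finiteDimensional hint
  haveI : FiniteDimensional ℚ ↥(K ⊔ IntermediateField.adjoin ℚ ({i₀} : Set (AlgebraicClosure ℚ))) :=
    IntermediateField.finiteDimensional_sup _ _
  haveI : NumberField ↥(K ⊔ IntermediateField.adjoin ℚ ({i₀} : Set (AlgebraicClosure ℚ))) := NumberField.of_module_finite ℚ _
  have hKF : finrank ℚ ↥K = finrank ℚ F := (LinearEquiv.finrank_eq φ.toLinearEquiv).symm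
  have hoddK : Odd (finrank ℚ ↥K) := by rw [hKF]; exact hodd
  -- one real place on the model; `K'` totally complex
  haveI : Subsingleton (↥K →+* ℝ) := by
    refine Function.Injective.subsingleton (f := fun ρ : ↥K →+* ℝ ↦ ρ.comp φ.toRingEquiv.toRingHom) fun ρ₁ ρ₂ h ↦ ?_
    refine RingHom.ext fun x ↦ ?_
    obtain ⟨y, rfl⟩ := φ.surjective x
    exact DFunLike.congr_fun h y
  have hiK' : i₀ ∈ K ⊔ IntermediateField.adjoin ℚ ({i₀} : Set (AlgebraicClosure ℚ)) :=
    (le_sup_right : IntermediateField.adjoin ℚ ({i₀} : Set (AlgebraicClosure ℚ)) ≤ K ⊔ _) (IntermediateField.mem_adjoin_simple_self ℚ i₀)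
  haveI : IsTotallyComplex ↥(K ⊔ IntermediateField.adjoin ℚ ({i₀} : Set (AlgebraicClosure ℚ))) :=
    ⟨FineSelmerUpstairs.isComplex_of_mem_sq_eq_neg_one i₀ hi₀ _ hiK'⟩
  letI : Algebra ↥K ↥(K ⊔ IntermediateField.adjoin ℚ ({i₀} : Set (AlgebraicClosure ℚ))) :=
    (IntermediateField.inclusion (le_sup_left : K ≤ K ⊔ IntermediateField.adjoin ℚ ({i₀} : Set (AlgebraicClosure ℚ)))).toRingHom.toAlgebra
  haveI : IsScalarTower ℚ ↥K ↥(K ⊔ IntermediateField.adjoin ℚ ({i₀} : Set (AlgebraicClosure ℚ))) :=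
    IsScalarTower.of_algebraMap_eq fun _ ↦ rfl
  have h2 : finrank ↥K ↥(K ⊔ IntermediateField.adjoin ℚ ({i₀} : Set (AlgebraicClosure ℚ))) = 2 := by
    have hmul := finrank_mul_finrank ℚ ↥K ↥(K ⊔ IntermediateField.adjoin ℚ ({i₀} : Set (AlgebraicClosure ℚ)))
    rw [finrank_sup_adjoin_eq_two_mul_of_odd K hoddK hi₀, mul_comm 2] at hmul
    exact Nat.eq_of_mul_eq_mul_left finrank_pos hmul
  -- transport the `μ`-input to the model (`√2 ∉ F`: odd degree)
  have hsq2 : ∀ x : F, x ^ 2 ≠ 2 := sq_ne_two_of_odd_finrank hodd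
  have hμK : ∀ κK : ZpExtension ↥K 2, κK.IsCyclotomic → ClassicalMuVanishes κK :=
    (forall_classicalMuVanishes_iff_of_algEquiv_of_forall_sq_ne_two φ hsq2).mp hμ
  -- Iwasawa's quadratic ascent `K ⊂ K(i)`, then genus theory backwards
  have hμK' : ∀ κ' : ZpExtension ↥(K ⊔ IntermediateField.adjoin ℚ ({i₀} : Set (AlgebraicClosure ℚ))) 2,
      κ'.IsCyclotomic → ClassicalMuVanishes κ' :=
    classicalMu_of_finrank_eq_two_of_subsingleton_realEmbedding ↥K _ h2 hμK
  obtain ⟨-, D, hδ⟩ := classicalMu_and_narrowDefect_le_of_classicalMu_sup_adjoin_of_sq_eq_neg_one K hoddK hi₀ hμK'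
  -- transport back along `φ`
  exact (exists_narrowDefect_le_iff_of_algEquiv_of_forall_sq_ne_two φ hsq2).mpr ⟨D, fun κ hκ n _ ↦ hδ κ hκ n⟩

/-- **The cubic case, keyed on `¬ IsTotallyReal F`**: for a cubic number field which is not totally real (one real place), `μ₂(F^cyc) = 0` ⟹ bounded narrow
`2`-defect along the cyclotomic `ℤ₂`-tower.  So in the sign-split named inputs of the cell `bsd-f1-sign2` (crux C2) the narrow clause is needed on the totally
real cubics only. [cite: Iwasawa1973MuInvariants, Thm. 2 and Thm. 3, §3–§4] [cite: Kida1982JFields, Thm. 1 (p. 340)] [cite: Washington1997, §13.3 Prop. 13.22–13.23] -/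
theorem exists_narrowDefect_le_of_classicalMu_of_not_isTotallyReal_cubic (F : Type) [Field F] [NumberField F] (hF : finrank ℚ F = 3)
    (hR : ¬ IsTotallyReal F) (hμ : ∀ κ : ZpExtension F 2, κ.IsCyclotomic → ClassicalMuVanishes κ) :
    ∃ D : ℕ, ∀ κ : ZpExtension F 2, κ.IsCyclotomic → ∀ n : ℕ, ∀ [NumberField ↥(κ.layer n)],
      padicValNat 2 (narrowClassNumber ↥(κ.layer n)) ≤ padicValNat 2 (NumberField.classNumber ↥(κ.layer n)) + D := by
  haveI := subsingleton_ringHom_real_of_nrRealPlaces_le_one F (nrRealPlaces_eq_one_of_not_isTotallyReal_cubic F hF hR).le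
  exact exists_narrowDefect_le_of_classicalMu_of_subsingleton_realEmbedding F (by rw [hF]; decide) hμ

/-- **Narrow ⟺ wide, as an `iff` on the cubic named inputs**: for a cubic number field which is not totally real,
«`μ₂ = 0` ∧ bounded narrow `2`-defect» ⟺ «`μ₂ = 0`». [cite: Kida1982JFields, Thm. 1 and Remark (ii)] [cite: Iwasawa1973MuInvariants, Thm. 3] -/
theorem classicalMu_and_narrowDefect_le_iff_of_not_isTotallyReal_cubic (F : Type) [Field F] [NumberField F] (hF : finrank ℚ F = 3)
    (hR : ¬ IsTotallyReal F) :
    ((∀ κ : ZpExtension F 2, κ.IsCyclotomic → ClassicalMuVanishes κ) ∧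
        ∃ D : ℕ, ∀ κ : ZpExtension F 2, κ.IsCyclotomic → ∀ n : ℕ, ∀ [NumberField ↥(κ.layer n)],
          padicValNat 2 (narrowClassNumber ↥(κ.layer n)) ≤ padicValNat 2 (NumberField.classNumber ↥(κ.layer n)) + D) ↔
      ∀ κ : ZpExtension F 2, κ.IsCyclotomic → ClassicalMuVanishes κ :=
  ⟨fun h ↦ h.1, fun h ↦ ⟨h, exists_narrowDefect_le_of_classicalMu_of_not_isTotallyReal_cubic F hF hR h⟩⟩

end Literature.NumberTheory.IwasawaTheory

end
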